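import Literature.Analysis.OperatorTheory.ContractionSemigroupLaplace
import Literature.MathematicalPhysics.QuantumLattice.OSContractionSemigroup
import Mathlib.Analysis.InnerProductSpace.Completion
import Mathlib.Analysis.Normed.Module.Completion
import Mathlib.Analysis.Normed.Operator.Extend
import HarnessLib

/-!
# Bounded positive-definite functions on the open half-line: the Laplace representation

`f : (0, ∞) → ℝ` is **positive definite on the semigroup `((0,∞), +)`** if the matrices
`(f (sᵢ + sⱼ))ᵢⱼ`, `sᵢ > 0`, are positive semidefinite (Berg–Christensen–Ressel, *Harmonic Analysis on
Semigroups* (1984), Ch. 4 §1; Widder, *The Laplace Transform* (1941), Ch. VI §21, Bernstein's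
"exponentially convex" functions). If `f` is also bounded on every `[t₀, ∞)`, `t₀ > 0`, it is a Laplace
transform of a positive measure on `[0, ∞)` (BCR Ch. 4 §4; Widder Thm VI.21 plus boundedness at `+∞`).
Main result (`IsBoundedHalfLinePD.exists_laplace_repr`): **for every `s > 0` there is a finite positive
measure `ν` on `[0, ∞)` with `f (2s + t) = ∫ e^{-tE} dν(E)` for all `t > 0`.** Proof: GNS construction
for the kernel `f (a + b)` on the free `ℂ`-module over `(0, ∞)` (`PreInnerProductSpace.Core`,
`UniformSpace.Completion`); the shifts `δ_a ↦ δ_{a+τ}` give self-adjoint contractions (Osterwalder–Schrader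
iteration `‖T_τ v‖² ≤ ‖v‖ ‖T_{2τ} v‖` against boundedness, `le_of_sq_le_mul_succ`); then the tree's spectral
Laplace representation `SymmContractionSemigroup.inner_eq_integral_rpow` (no strong continuity needed) at
the vector `δ_s`, `⟪δ_s, T_t δ_s⟫ = f (2s + t)`. Used by route CriticalPhenomena/…/HyperoctahedralRP
(crux `HRP2Rigidity`, half-plane continuation of reflection-positive kernels). NOT here: the holomorphic
extension (`HalfLinePositiveDefiniteHolomorphic.lean`), uniqueness of `ν`, the limit `s → 0`, Bernstein's
theorem. References: [BergChristensenRessel1984] Ch. 4 §1–§4; [Widder1941] Ch. VI §21.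
-/

noncomputable section

open MeasureTheory Filter Finsupp
open _root_.Topology
open scoped InnerProductSpace ComplexConjugate BigOperators

namespace Literature.Analysis.OperatorTheory

/-- **Bounded positive-definite function on the open half-line**: `∑ᵢⱼ cᵢ cⱼ f (sᵢ + sⱼ) ≥ 0` for all
finite families `sᵢ > 0` and real `cᵢ`, and `f` bounded on every `[t₀, ∞)`, `t₀ > 0` (values on `(-∞, 0]`
are irrelevant). [cite: BergChristensenRessel1984, Ch. 4 §1 Def. 1.1] -/
structure IsBoundedHalfLinePD (f : ℝ → ℝ) : Prop where
  posDef : ∀ (m : ℕ) (s : Fin m → ℝ) (c : Fin m → ℝ), (∀ a, 0 < s a) →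
    0 ≤ ∑ a, ∑ b, c a * c b * f (s a + s b)
  bdd : ∀ t₀ : ℝ, 0 < t₀ → ∃ M : ℝ, ∀ t : ℝ, t₀ ≤ t → |f t| ≤ M

namespace IsBoundedHalfLinePD

variable {f : ℝ → ℝ}

/-- Positive definiteness for families indexed by an arbitrary finite type. [folklore] -/
theorem posDef_fintype (hf : IsBoundedHalfLinePD f) {ι : Type*} [Fintype ι] (s : ι → ℝ) (c : ι → ℝ)
    (hs : ∀ i, 0 < s i) : 0 ≤ ∑ i, ∑ j, c i * c j * f (s i + s j) := by
  classical
  set e := Fintype.equivFin ι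
  have h := hf.posDef (Fintype.card ι) (s ∘ e.symm) (c ∘ e.symm) (fun a => hs _)
  rw [← e.symm.sum_comp]
  convert h using 2 with a
  exact (e.symm.sum_comp _).symm

/-- A positive-definite function is nonnegative on `(0, ∞)` (one point `t/2`). [folklore] -/
theorem nonneg (hf : IsBoundedHalfLinePD f) {t : ℝ} (ht : 0 < t) : 0 ≤ f t := by
  simpa [add_halves] using hf.posDef 1 (fun _ => t / 2) (fun _ => 1) (fun _ => by positivity)

/-! ### The sesquilinear form on the free module over `(0, ∞)` -/

/-- The points of the open half-line. [folklore] -/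
abbrev Pt : Type := {x : ℝ // 0 < x}

/-- **The GNS form** `⟪v, w⟫ = ∑_{a,b} conj (v a) · w b · f (a + b)` on the free module. [folklore] -/
def form (f : ℝ → ℝ) (v w : Pt →₀ ℂ) : ℂ :=
  conj (Finsupp.linearCombination ℂ
    (fun a : Pt => conj (Finsupp.linearCombination ℂ (fun b : Pt => ((f (a + b) : ℝ) : ℂ)) w)) v)

/-- The form as a double sum over the supports. [folklore] -/
theorem form_eq_sum (v w : Pt →₀ ℂ) :
    form f v w = ∑ a ∈ v.support, ∑ b ∈ w.support, conj (v a) * w b * f (a + b) := by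
  simp only [form, Finsupp.linearCombination_apply, Finsupp.sum, smul_eq_mul, map_sum, map_mul,
    Complex.conj_conj, Finset.mul_sum, Complex.conj_ofReal]
  refine Finset.sum_congr rfl fun a _ => Finset.sum_congr rfl fun b _ => ?_
  ring

/-- Additivity in the first argument. [folklore] -/
theorem form_add_left (x y z : Pt →₀ ℂ) : form f (x + y) z = form f x z + form f y z := by
  simp [form, map_add]

/-- Conjugate homogeneity in the first argument. [folklore] -/
theorem form_smul_left (x y : Pt →₀ ℂ) (r : ℂ) : form f (r • x) y = conj r * form f x y := by
  simp [form, map_smul]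

/-- The form on basis vectors: `⟪δ_a, δ_b⟫ = conj α · β · f (a + b)`. [folklore] -/
@[simp] theorem form_single_single (a b : Pt) (α β : ℂ) :
    form f (Finsupp.single a α) (Finsupp.single b β) = conj α * β * f (a + b) := by
  simp only [form, Finsupp.linearCombination_single, smul_eq_mul, map_mul, Complex.conj_conj,
    Complex.conj_ofReal]
  ring

/-- Hermitian symmetry (the kernel `f (a + b)` is real and symmetric). [folklore] -/
theorem conj_form (x y : Pt →₀ ℂ) : conj (form f y x) = form f x y := by
  rw [form_eq_sum, form_eq_sum, map_sum, Finset.sum_comm]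
  refine Finset.sum_congr rfl fun a _ => ?_
  rw [map_sum]
  refine Finset.sum_congr rfl fun b _ => ?_
  rw [map_mul, map_mul, Complex.conj_conj, Complex.conj_ofReal, add_comm]
  ring

/-- The form after relabelling both arguments (`Finsupp.mapDomain`). [folklore] -/
theorem form_mapDomain (φ ψ : Pt → Pt) (v w : Pt →₀ ℂ) :
    form f (Finsupp.mapDomain φ v) (Finsupp.mapDomain ψ w) =
      ∑ a ∈ v.support, ∑ b ∈ w.support, conj (v a) * w b * f (φ a + ψ b) := by
  simp only [form]
  rw [Finsupp.linearCombination_mapDomain, Finsupp.linearCombination_apply, Finsupp.sum, map_sum]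
  refine Finset.sum_congr rfl fun a _ => ?_
  simp only [Function.comp_apply, smul_eq_mul, map_mul, Complex.conj_conj]
  rw [Finsupp.linearCombination_mapDomain, Finsupp.linearCombination_apply, Finsupp.sum,
    Finset.mul_sum]
  refine Finset.sum_congr rfl fun b _ => ?_
  simp only [Function.comp_apply, smul_eq_mul]
  ring

/-- **Positivity** `0 ≤ Re ⟪v, v⟫` (real positive definiteness on real and imaginary parts). [folklore] -/
theorem form_self_re_nonneg (hf : IsBoundedHalfLinePD f) (v : Pt →₀ ℂ) : 0 ≤ (form f v v).re := by
  have key : ∀ c : Pt → ℝ, 0 ≤ ∑ a ∈ v.support, ∑ b ∈ v.support, c a * c b * f (a + b) := by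
    intro c
    have h := hf.posDef_fintype (ι := v.support) (fun a => ((a : Pt) : ℝ)) (fun a => c a)
      (fun a => (a : Pt).2)
    calc (0 : ℝ) ≤ _ := h
      _ = ∑ a ∈ v.support, ∑ b ∈ v.support, c a * c b * f (a + b) := by
          rw [Finset.sum_coe_sort v.support (fun a => ∑ j : v.support, c a * c j * f (a + j))]
          refine Finset.sum_congr rfl fun a _ => ?_
          exact Finset.sum_coe_sort v.support (fun b => c a * c b * f (a + b))
  rw [form_eq_sum, Complex.re_sum]
  have hre : ∀ a ∈ v.support, (∑ b ∈ v.support, conj (v a) * v b * (f (a + b) : ℂ)).re =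
      ∑ b ∈ v.support, ((v a).re * (v b).re * f (a + b) + (v a).im * (v b).im * f (a + b)) := by
    intro a _
    rw [Complex.re_sum]
    refine Finset.sum_congr rfl fun b _ => ?_
    simp only [Complex.mul_re, Complex.mul_im, Complex.conj_re, Complex.conj_im,
      Complex.ofReal_re, Complex.ofReal_im]
    ring
  rw [Finset.sum_congr rfl hre]
  simp only [Finset.sum_add_distrib]
  exact add_nonneg (key fun a => (v a).re) (key fun a => (v a).im)

/-! ### The GNS pre-Hilbert space, its completion, and the shift semigroup -/

/-- **The GNS pre-Hilbert space**: the free `ℂ`-module over `(0, ∞)` as a type synonym carrying the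
semi-inner product `form f` (the hypothesis is a parameter of the type, for the instances). [folklore] -/
@[nolint unusedArguments]
def Pre (_hf : IsBoundedHalfLinePD f) : Type := Pt →₀ ℂ

variable (hf : IsBoundedHalfLinePD f)

/-- The free module structure (group). [folklore] -/
instance : AddCommGroup hf.Pre := inferInstanceAs (AddCommGroup (Pt →₀ ℂ))
/-- The free module structure (`ℂ`-module). [folklore] -/
instance : Module ℂ hf.Pre := inferInstanceAs (Module ℂ (Pt →₀ ℂ))

/-- The identification of the free module with the pre-Hilbert space. [folklore] -/
def toPre : (Pt →₀ ℂ) ≃ₗ[ℂ] hf.Pre := LinearEquiv.refl ℂ _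

/-- The GNS form as a `PreInnerProductSpace.Core`. [folklore] -/
instance instCore : PreInnerProductSpace.Core ℂ hf.Pre where
  inner v w := form f (hf.toPre.symm v) (hf.toPre.symm w)
  conj_inner_symm v w := conj_form _ _
  re_inner_nonneg v := by
    show 0 ≤ RCLike.re (form f _ _)
    exact form_self_re_nonneg hf _
  add_left x y z := by simp only [map_add, form_add_left]
  smul_left x y r := by simp only [map_smul, form_smul_left]

/-- The seminormed group structure `‖v‖ = √⟪v, v⟫` (null vectors allowed). [folklore] -/
instance instSeminormedAddCommGroup : SeminormedAddCommGroup hf.Pre :=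
  @InnerProductSpace.Core.toSeminormedAddCommGroup ℂ _ _ _ _ hf.instCore

/-- The (semi-)inner product space structure. [folklore] -/
instance instInnerProductSpace : InnerProductSpace ℂ hf.Pre := InnerProductSpace.ofCore hf.instCore

/-- **The GNS Hilbert space**: the completion (which identifies null vectors). [folklore] -/
abbrev Hilb : Type := UniformSpace.Completion hf.Pre

/-- The canonical linear map from the free module to the Hilbert space. [folklore] -/
def vec : (Pt →₀ ℂ) →ₗ[ℂ] hf.Hilb :=
  (UniformSpace.Completion.toComplₗᵢ : hf.Pre →ₗᵢ[ℂ] hf.Hilb).toLinearMap ∘ₗ hf.toPre.toLinearMap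

/-- `vec` is the coercion into the completion. [folklore] -/
theorem vec_apply (v : Pt →₀ ℂ) : hf.vec v = ((hf.toPre v : hf.Pre) : hf.Hilb) := rfl

/-- `vec` has dense range. [folklore] -/
theorem denseRange_vec : DenseRange hf.vec :=
  (UniformSpace.Completion.denseRange_coe : DenseRange ((↑) : hf.Pre → hf.Hilb))

/-- `⟪vec v, vec w⟫ = form f v w`. [folklore] -/
@[simp] theorem inner_vec_vec (v w : Pt →₀ ℂ) : ⟪hf.vec v, hf.vec w⟫_ℂ = form f v w := by
  rw [vec_apply, vec_apply, UniformSpace.Completion.inner_coe]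
  rfl

/-- `‖vec v‖² = Re (form f v v)`. [folklore] -/
theorem norm_vec_sq (v : Pt →₀ ℂ) : ‖hf.vec v‖ ^ 2 = (form f v v).re := by
  have h := inner_self_eq_norm_sq (𝕜 := ℂ) (hf.vec v)
  rw [inner_vec_vec] at h
  exact_mod_cast h.symm

/-- The shift of the half-line by `max τ 0` (the identity for `τ ≤ 0`). [folklore] -/
def shiftPt (τ : ℝ) (a : Pt) : Pt := ⟨(a : ℝ) + max τ 0, add_pos_of_pos_of_nonneg a.2 (le_max_right _ _)⟩

/-- Coordinates of the shifted point. [folklore] -/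
@[simp] theorem coe_shiftPt (τ : ℝ) (a : Pt) : ((shiftPt τ a : Pt) : ℝ) = a + max τ 0 := rfl

/-- Shifts compose additively for nonnegative parameters. [folklore] -/
theorem shiftPt_shiftPt {σ τ : ℝ} (hσ : 0 ≤ σ) (hτ : 0 ≤ τ) (a : Pt) :
    shiftPt σ (shiftPt τ a) = shiftPt (σ + τ) a := by
  apply Subtype.ext
  simp only [coe_shiftPt, max_eq_left hσ, max_eq_left hτ, max_eq_left (add_nonneg hσ hτ)]
  ring

/-- **The shift operator on the free module**, `δ_a ↦ δ_{a + τ}` (`τ ≥ 0`). [folklore] -/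
def preShift (τ : ℝ) : (Pt →₀ ℂ) →ₗ[ℂ] (Pt →₀ ℂ) := Finsupp.lmapDomain ℂ ℂ (shiftPt τ)

/-- The shift relabels the basis. [folklore] -/
theorem preShift_apply (τ : ℝ) (v : Pt →₀ ℂ) : preShift τ v = Finsupp.mapDomain (shiftPt τ) v := rfl

/-- The semigroup law on the free module. [folklore] -/
theorem preShift_preShift {σ τ : ℝ} (hσ : 0 ≤ σ) (hτ : 0 ≤ τ) (v : Pt →₀ ℂ) :
    preShift σ (preShift τ v) = preShift (σ + τ) v := by
  rw [preShift_apply, preShift_apply, preShift_apply, ← Finsupp.mapDomain_comp]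
  congr 1
  funext a
  exact shiftPt_shiftPt hσ hτ a

/-- **Symmetry of the shift**: `⟪T_τ v, w⟫ = ⟪v, T_τ w⟫` (`= ∑ conj (v a) w b f (a + b + τ)`). [folklore] -/
theorem form_preShift_left (τ : ℝ) (v w : Pt →₀ ℂ) :
    form f (preShift τ v) w = form f v (preShift τ w) := by
  have h1 := form_mapDomain (f := f) (shiftPt τ) id v w
  have h2 := form_mapDomain (f := f) id (shiftPt τ) v w
  rw [Finsupp.mapDomain_id] at h1 h2
  rw [preShift_apply, preShift_apply, h1, h2]
  refine Finset.sum_congr rfl fun a _ => Finset.sum_congr rfl fun b _ => ?_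
  simp only [id, coe_shiftPt]
  congr 2
  ring

/-- `form f v (T_σ v) = ∑ conj (v a) v b f (a + b + max σ 0)`. [folklore] -/
theorem form_preShift_eq_sum (σ : ℝ) (v : Pt →₀ ℂ) :
    form f v (preShift σ v) = ∑ a ∈ v.support, ∑ b ∈ v.support, conj (v a) * v b * f (a + b + max σ 0) := by
  have h := form_mapDomain (f := f) id (shiftPt σ) v v
  rw [Finsupp.mapDomain_id] at h
  rw [preShift_apply, h]
  refine Finset.sum_congr rfl fun a _ => Finset.sum_congr rfl fun b _ => ?_
  simp only [id, coe_shiftPt, add_assoc]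

include hf in
/-- **Uniform bound** `‖form f v (T_σ v)‖ ≤ C_v` (finite supports in `(0,∞)`, `f` bounded on `[t₀,∞)`). [folklore] -/
theorem exists_norm_form_preShift_le (v : Pt →₀ ℂ) :
    ∃ C : ℝ, ∀ σ : ℝ, ‖form f v (preShift σ v)‖ ≤ C := by
  classical
  obtain ⟨t₀, ht₀, hle⟩ : ∃ t₀ : ℝ, 0 < t₀ ∧ ∀ a ∈ v.support, t₀ ≤ (a : ℝ) := by
    by_cases hs : v.support.Nonempty
    · obtain ⟨a₀, ha₀, hmin⟩ := v.support.exists_min_image (fun a : Pt => (a : ℝ)) hs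
      exact ⟨a₀, a₀.2, fun a ha => hmin a ha⟩
    · refine ⟨1, one_pos, fun a ha => ?_⟩
      exact absurd ⟨a, ha⟩ hs
  obtain ⟨M, hM⟩ := hf.bdd t₀ ht₀
  refine ⟨∑ a ∈ v.support, ∑ b ∈ v.support, ‖v a‖ * ‖v b‖ * M, fun σ => ?_⟩
  rw [form_preShift_eq_sum]
  refine (norm_sum_le _ _).trans (Finset.sum_le_sum fun a ha => ?_)
  refine (norm_sum_le _ _).trans (Finset.sum_le_sum fun b hb => ?_)
  rw [norm_mul, norm_mul, Complex.norm_conj, Complex.norm_real, Real.norm_eq_abs]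
  refine mul_le_mul_of_nonneg_left (hM _ ?_) (by positivity)
  have ha' := hle a ha
  have hb' := (hle b hb).trans_lt' ht₀
  have : 0 ≤ max σ 0 := le_max_right _ _
  linarith [b.2]

/-- `‖vec (T_τ v)‖² = Re form f v (T_{2τ} v)` (`τ ≥ 0`; symmetry and the semigroup law). [folklore] -/
theorem norm_vec_preShift_sq {τ : ℝ} (hτ : 0 ≤ τ) (v : Pt →₀ ℂ) :
    ‖hf.vec (preShift τ v)‖ ^ 2 = (form f v (preShift (2 * τ) v)).re := by
  rw [hf.norm_vec_sq, form_preShift_left, preShift_preShift hτ hτ, two_mul]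

/-- The iteration inequality `‖vec (T_τ v)‖² ≤ ‖vec v‖ · ‖vec (T_{2τ} v)‖`. [folklore] -/
theorem norm_vec_preShift_sq_le {τ : ℝ} (hτ : 0 ≤ τ) (v : Pt →₀ ℂ) :
    ‖hf.vec (preShift τ v)‖ ^ 2 ≤ ‖hf.vec v‖ * ‖hf.vec (preShift (2 * τ) v)‖ := by
  rw [norm_vec_preShift_sq hf hτ, ← hf.inner_vec_vec]
  exact (Complex.re_le_norm _).trans (norm_inner_le_norm _ _)

/-- **Contraction on the dense domain** `‖vec (T_τ v)‖ ≤ ‖vec v‖` (OS iteration vs the uniform bound). [folklore] -/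
theorem norm_vec_preShift_le (τ : ℝ) (v : Pt →₀ ℂ) : ‖hf.vec (preShift τ v)‖ ≤ ‖hf.vec v‖ := by
  have hτ : 0 ≤ max τ 0 := le_max_right _ _
  have hshift : shiftPt τ = shiftPt (max τ 0) := by
    funext a
    apply Subtype.ext
    simp only [coe_shiftPt, max_eq_left hτ]
  have hpre : preShift τ = preShift (max τ 0) := by
    simp only [preShift, hshift]
  rw [hpre]
  obtain ⟨C, hC⟩ := exists_norm_form_preShift_le hf v
  set a : ℕ → ℝ := fun n => ‖hf.vec (preShift (2 ^ n * max τ 0) v)‖ with ha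
  have hsq : ∀ n, a n ^ 2 ≤ ‖hf.vec v‖ * a (n + 1) := fun n => by
    have := hf.norm_vec_preShift_sq_le (τ := 2 ^ n * max τ 0) (by positivity) v
    simpa [a, pow_succ, mul_comm, mul_assoc, mul_left_comm] using this
  have hbdd : ∀ n, a n ≤ Real.sqrt C := fun n => by
    refine Real.le_sqrt_of_sq_le ?_
    rw [ha]
    dsimp only
    rw [norm_vec_preShift_sq hf (by positivity)]
    exact (Complex.re_le_norm _).trans (hC _)
  have := Literature.MathematicalPhysics.QuantumLattice.le_of_sq_le_mul_succ (norm_nonneg (hf.vec v))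
    hbdd hsq
  simpa [a] using this

/-- **The shift operator `T_τ` on the GNS Hilbert space** (extension by continuity, `extendOfNorm`). [folklore] -/
def transfer (τ : ℝ) : hf.Hilb →L[ℂ] hf.Hilb := (hf.vec ∘ₗ preShift τ).extendOfNorm hf.vec

/-- `T_τ (vec v) = vec (T_τ v)`. [folklore] -/
@[simp] theorem transfer_vec (τ : ℝ) (v : Pt →₀ ℂ) : hf.transfer τ (hf.vec v) = hf.vec (preShift τ v) :=
  LinearMap.extendOfNorm_eq hf.denseRange_vec ⟨1, fun w => by
    simpa using hf.norm_vec_preShift_le τ w⟩ v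

/-- `T_τ` is a contraction. [folklore] -/
theorem norm_transfer_le (τ : ℝ) : ‖hf.transfer τ‖ ≤ 1 := by
  refine ContinuousLinearMap.opNorm_le_bound _ zero_le_one fun ψ => ?_
  exact LinearMap.norm_extendOfNorm_apply_le hf.denseRange_vec 1 (fun w => by
    simpa using hf.norm_vec_preShift_le τ w) ψ

/-- Semigroup law `T_{σ+τ} = T_σ T_τ` for `σ, τ ≥ 0`. [folklore] -/
theorem transfer_add {σ τ : ℝ} (hσ : 0 ≤ σ) (hτ : 0 ≤ τ) :
    hf.transfer (σ + τ) = hf.transfer σ * hf.transfer τ := by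
  refine ContinuousLinearMap.ext fun ψ => ?_
  refine hf.denseRange_vec.induction_on ψ ?_ fun v => ?_
  · exact isClosed_eq (hf.transfer (σ + τ)).continuous
      ((hf.transfer σ).continuous.comp (hf.transfer τ).continuous)
  · change hf.transfer (σ + τ) (hf.vec v) = hf.transfer σ (hf.transfer τ (hf.vec v))
    rw [transfer_vec, transfer_vec, transfer_vec, preShift_preShift hσ hτ]

/-- `T_τ` is symmetric. [folklore] -/
theorem inner_transfer_left (τ : ℝ) (φ ψ : hf.Hilb) : ⟪hf.transfer τ φ, ψ⟫_ℂ = ⟪φ, hf.transfer τ ψ⟫_ℂ := by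
  refine hf.denseRange_vec.induction_on φ ?_ fun v => ?_
  · exact isClosed_eq ((hf.transfer τ).continuous.inner continuous_const) (continuous_id.inner continuous_const)
  · refine hf.denseRange_vec.induction_on ψ ?_ fun w => ?_
    · exact isClosed_eq (continuous_const.inner continuous_id) (continuous_const.inner (hf.transfer τ).continuous)
    · rw [transfer_vec, transfer_vec, inner_vec_vec, inner_vec_vec, form_preShift_left]

/-- `T_τ` is self-adjoint. [folklore] -/
theorem isSelfAdjoint_transfer (τ : ℝ) : IsSelfAdjoint (hf.transfer τ) := by
  rw [ContinuousLinearMap.isSelfAdjoint_iff_isSymmetric]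
  exact fun φ ψ => hf.inner_transfer_left τ φ ψ

/-- The matrix element `⟪vec δ_s, T_t vec δ_s⟫ = f (2s + t)` (`t ≥ 0`). [folklore] -/
theorem inner_vec_single_transfer {s : Pt} {t : ℝ} (ht : 0 ≤ t) :
    ⟪hf.vec (Finsupp.single s 1), hf.transfer t (hf.vec (Finsupp.single s 1))⟫_ℂ = f (2 * s + t) := by
  rw [transfer_vec, inner_vec_vec, preShift_apply, Finsupp.mapDomain_single, form_single_single]
  simp only [map_one, one_mul, coe_shiftPt, max_eq_left ht]
  congr 2
  ring

include hf in
/-- **Laplace representation of the shifted function**: for every `s > 0` there is a finite positive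
measure `ν` on `[0, ∞)` with `f (2s + t) = ∫ e^{-tE} dν(E)` for all `t > 0` (the spectral measure of
`δ_s` for the GNS shift semigroup; BCR 1984 Ch. 4 §4, Widder 1941 Thm VI.21 + boundedness at `+∞`).
[cite: BergChristensenRessel1984, Ch. 4 §4] -/
theorem exists_laplace_repr {s : ℝ} (hs : 0 < s) :
    ∃ ν : Measure ℝ, IsFiniteMeasure ν ∧ ν (Set.Iio 0) = 0 ∧
      ∀ t : ℝ, 0 < t → f (2 * s + t) = ∫ E, Real.exp (-(t * E)) ∂ν := by
  set S : ℝ → hf.Hilb →L[ℂ] hf.Hilb := hf.transfer with hS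
  have hadd : ∀ s t : ℝ, 0 < s → 0 < t → S (s + t) = S s * S t := fun s t hs' ht' =>
    hf.transfer_add hs'.le ht'.le
  have hsa : ∀ t : ℝ, 0 < t → IsSelfAdjoint (S t) := fun t _ => hf.isSelfAdjoint_transfer t
  have hcontr : ∀ t : ℝ, 0 < t → ‖S t‖ ≤ 1 := fun t _ => hf.norm_transfer_le t
  set ψ : hf.Hilb := hf.vec (Finsupp.single ⟨s, hs⟩ 1) with hψ
  set μ := scalarSpectralMeasure (S 1) (hsa 1 one_pos) ψ with hμ
  set μ' := μ.restrict {x | (x : ℝ) ≠ 0} with hμ'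
  set g : spectrum ℝ (S 1) → ℝ := fun x => -Real.log (x : ℝ) with hg
  have hgm : Measurable g := (Real.measurable_log.comp measurable_subtype_coe).neg
  haveI : IsFiniteMeasure μ := by
    refine ⟨?_⟩
    rw [hμ, scalarSpectralMeasure_univ]
    exact ENNReal.ofReal_lt_top
  haveI : IsFiniteMeasure μ' := by rw [hμ']; infer_instance
  refine ⟨μ'.map g, inferInstance, ?_, fun t ht => ?_⟩
  · rw [Measure.map_apply hgm measurableSet_Iio]
    have : g ⁻¹' Set.Iio 0 = ∅ := by
      ext x
      simp only [Set.mem_preimage, Set.mem_Iio, Set.mem_empty_iff_false, iff_false, not_lt, hg,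
        Left.nonneg_neg_iff]
      obtain ⟨h0', h1'⟩ := SymmContractionSemigroup.coe_mem_Icc hadd hsa hcontr x
      exact Real.log_nonpos h0' h1'
    rw [this, measure_empty]
  · have hrep := SymmContractionSemigroup.inner_eq_integral_rpow hadd hsa hcontr ψ ht
    have hlhs : ⟪ψ, S t ψ⟫_ℂ = f (2 * s + t) := hf.inner_vec_single_transfer ht.le
    rw [hlhs] at hrep
    have hrep' : f (2 * s + t) = ∫ x, (x : ℝ) ^ t ∂μ := by exact_mod_cast hrep
    rw [hrep', integral_map hgm.aemeasurable (by fun_prop)]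
    have hmeas : MeasurableSet {x : spectrum ℝ (S 1) | (x : ℝ) ≠ 0} :=
      measurable_subtype_coe (measurableSet_singleton (0 : ℝ)).compl
    have h1 : ∫ x, (x : ℝ) ^ t ∂μ = ∫ x, (x : ℝ) ^ t ∂μ' := by
      rw [hμ', ← integral_indicator hmeas]
      · refine integral_congr_ae (ae_of_all _ fun x => ?_)
        by_cases hx : (x : ℝ) ≠ 0
        · rw [Set.indicator_of_mem (by exact hx)]
        · push Not at hx
          rw [Set.indicator_of_notMem (by simpa using hx)]
          show (x : ℝ) ^ t = 0
          rw [hx, Real.zero_rpow ht.ne']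
    rw [h1]
    refine integral_congr_ae ?_
    have hae : ∀ᵐ x : spectrum ℝ (S 1) ∂μ', (x : ℝ) ≠ 0 := by
      rw [hμ']
      filter_upwards [ae_restrict_mem hmeas] with x hx
      exact hx
    filter_upwards [hae] with x hx
    have hxpos : 0 < (x : ℝ) :=
      lt_of_le_of_ne (SymmContractionSemigroup.coe_mem_Icc hadd hsa hcontr x).1 (Ne.symm hx)
    simp only [hg, mul_neg, neg_neg]
    rw [Real.rpow_def_of_pos hxpos, mul_comm]

end IsBoundedHalfLinePD

end Literature.Analysis.OperatorTheory

end
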